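import Literature.Geometry.Symplectic.CompatibleMetricSelfDual
import Literature.Geometry.Symplectic.SymplecticOrientation
import Literature.Geometry.GaugeTheory.SpincStructure
import HarnessLib

/-!
# Unitary frames of an almost Kähler `4`-manifold are positive for the symplectic orientation

Topic `Literature/Geometry/Symplectic`; continues `CompatibleMetricSelfDual.lean` (in a unitary
frame `(e₀, Je₀, e₂, Je₂)` of the metric `g_J` of an `s`-compatible `J`, the form `s` reads
`e⁰¹ + e²³`) and `SymplecticOrientation.lean` (the symplectic smooth orientation
`sign Pf(s_y) · [∂₀, …, ∂₃]`).

D. McDuff, D. Salamon, *Introduction to Symplectic Topology* (3rd ed., 2017), §2.1 (Cor. 2.1.4: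
`ω ∧ ω` orients), §4.1 ((4.1.2): `g_J = ω(·, J·)`; an `ω`-compatible `J` induces the symplectic
orientation); C. H. Taubes, Math. Res. Lett. 2 (1995), §5 Step 1 ("`ω` is self-dual": the
orientation used for the Seiberg–Witten equations of a symplectic manifold is the symplectic one,
for which unitary frames are positive).

PROVED here (0 new facts): **a `g_J`-orthonormal `J`-adapted frame is a positively oriented
orthonormal frame for the symplectic smooth orientation** (`isPosOrthonormalFrame_of_unitary`), in
the sense `IsPosOrthonormalFrame` of the tree's gauge theory (`Literature/Geometry/GaugeTheory`).
Proof: with `L ∂ᵢ = eᵢ` (`Basis.constrL`), `Pf(L*α) = det L · Pf(α)` (`pfaffian_compContinuousLinearMap`) and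
`Pf(L*α) = Pf(e⁰¹ + e²³) = 1`, so `det L` has the sign of `Pf(α)`, which is exactly positivity
for `sign Pf(α) · [∂₀, …, ∂₃]`. The linear algebra is done on the model `ℝ⁴`
(`isPosFrame_of_twoForm_eq`) and transported to the manifold by definitional unfolding.

## References

* D. McDuff, D. Salamon, *Introduction to Symplectic Topology*, 3rd ed., OUP (2017), §2.1
  Cor. 2.1.4, §4.1 (4.1.2). [McDuffSalamon2017]
* C. H. Taubes, *The Seiberg–Witten and Gromov invariants*, Math. Res. Lett. 2 (1995) 221–238,
  §5 Step 1. [Taubes1995]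
-/

noncomputable section

open scoped Manifold ContDiff
open Module Literature.Geometry.Kaehler Literature.Geometry.GaugeTheory Literature.Topology.FourManifolds
open Literature.Geometry.Lorentzian (PseudoRiemannianMetric)

namespace Literature.Geometry.Symplectic

/-! ### Model linear algebra on `ℝ⁴` -/

section Model

/-- The linear map `L = constrL e` of `ℝ⁴` sending the standard basis vector `∂_j` to `e_j`
(Mathlib's `Basis.constrL` on the standard orthonormal basis) does so on `stdVec j`. [folklore] -/
theorem constrL_stdVec (e : Fin 4 → EuclideanSpace ℝ (Fin 4)) (j : Fin 4) :
    (EuclideanSpace.basisFun (Fin 4) ℝ).toBasis.constrL e (stdVec j) = e j := by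
  have hj : stdVec j = (EuclideanSpace.basisFun (Fin 4) ℝ).toBasis j := by
    rw [OrthonormalBasis.coe_toBasis, EuclideanSpace.basisFun_apply]; rfl
  rw [hj, Basis.constrL_basis]

/-- `det (constrL e)` is the determinant of `e` in the standard basis. [folklore] -/
theorem det_constrL (e : Fin 4 → EuclideanSpace ℝ (Fin 4)) :
    LinearMap.det ((EuclideanSpace.basisFun (Fin 4) ℝ).toBasis.constrL e :
        EuclideanSpace ℝ (Fin 4) →ₗ[ℝ] EuclideanSpace ℝ (Fin 4)) =
      (EuclideanSpace.basisFun (Fin 4) ℝ).toBasis.det e := by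
  rw [linearMap_det_eq_det_coords, Basis.det_apply]
  congr 1
  ext i j
  simp [Matrix.of_apply, Basis.toMatrix_apply]

/-- **`Pf = 1` in a frame where `α = e⁰¹ + e²³`.** [cite: McDuffSalamon2017, §2.1 Cor. 2.1.4] -/
theorem pfaffian_compContinuousLinearMap_constrL {α : (EuclideanSpace ℝ (Fin 4)) [⋀^Fin 2]→L[ℝ] ℝ}
    {e : Fin 4 → EuclideanSpace ℝ (Fin 4)}
    (hM : (Matrix.of fun a b : Fin 4 ↦ α ![e a, e b]) = !![0, 1, 0, 0; -1, 0, 0, 0; 0, 0, 0, 1; 0, 0, -1, 0]) :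
    pfaffian (α.compContinuousLinearMap ((EuclideanSpace.basisFun (Fin 4) ℝ).toBasis.constrL e)) = 1 := by
  have hab : ∀ a b : Fin 4, α ![e a, e b] = !![(0 : ℝ), 1, 0, 0; -1, 0, 0, 0; 0, 0, 0, 1; 0, 0, -1, 0] a b :=
    fun a b ↦ by rw [← hM]; rfl
  have hc : ∀ a b : Fin 4,
      (((EuclideanSpace.basisFun (Fin 4) ℝ).toBasis.constrL e :
          EuclideanSpace ℝ (Fin 4) → EuclideanSpace ℝ (Fin 4)) ∘ ![stdVec a, stdVec b]) =
        ![e a, e b] := fun a b ↦ by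
    funext k
    fin_cases k <;> simp
  simp only [pfaffian, ContinuousAlternatingMap.compContinuousLinearMap_apply, hc, hab]
  simp

/-- **`det` of such a frame has the sign of `Pf(α)`**: `det(e) · Pf(α) = 1` (determinant in the
standard basis). [cite: McDuffSalamon2017, §2.1 Cor. 2.1.4] -/
theorem det_mul_pfaffian_eq_one {α : (EuclideanSpace ℝ (Fin 4)) [⋀^Fin 2]→L[ℝ] ℝ}
    {e : Fin 4 → EuclideanSpace ℝ (Fin 4)}
    (hM : (Matrix.of fun a b : Fin 4 ↦ α ![e a, e b]) = !![0, 1, 0, 0; -1, 0, 0, 0; 0, 0, 0, 1; 0, 0, -1, 0]) :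
    (EuclideanSpace.basisFun (Fin 4) ℝ).toBasis.det e * pfaffian α = 1 := by
  rw [← det_constrL, ← pfaffian_compContinuousLinearMap, pfaffian_compContinuousLinearMap_constrL hM]

variable {N : Type*} [TopologicalSpace N] [ChartedSpace (EuclideanSpace ℝ (Fin 4)) N] [IsManifold (𝓡 4) ∞ N]

/-- **A frame in which `α = e⁰¹ + e²³` is positive for the orientation `sign Pf(α) · [∂₀, …, ∂₃]`**
(model statement, for any smooth orientation `o` whose value at `x` is that sign orientation).
[cite: McDuffSalamon2017, §2.1 Cor. 2.1.4] -/
theorem isPosFrame_of_twoForm_eq (o : SmoothOrientation (𝓡 4) N) (x : N)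
    {α : (EuclideanSpace ℝ (Fin 4)) [⋀^Fin 2]→L[ℝ] ℝ} (hox : o x = signOrientationIn 4 (pfaffian α))
    {e : Fin 4 → EuclideanSpace ℝ (Fin 4)} (hli : LinearIndependent ℝ e)
    (hM : (Matrix.of fun a b : Fin 4 ↦ α ![e a, e b]) = !![0, 1, 0, 0; -1, 0, 0, 0; 0, 0, 0, 1; 0, 0, -1, 0]) :
    o.IsPosFrame x (e ∘ finCongr finrank_euclideanSpace_fin) := by
  classical
  set σ : Fin (finrank ℝ (EuclideanSpace ℝ (Fin 4))) ≃ Fin 4 := finCongr finrank_euclideanSpace_fin with hσ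
  -- the frame as a basis, reindexed to `Fin (finrank ℝ ℝ⁴)`
  set b : Basis (Fin 4) ℝ (EuclideanSpace ℝ (Fin 4)) :=
    basisOfLinearIndependentOfCardEqFinrank hli (by simp) with hb
  have hbcoe : ⇑b = e := coe_basisOfLinearIndependentOfCardEqFinrank hli _
  set b' : Basis (Fin (finrank ℝ (EuclideanSpace ℝ (Fin 4)))) ℝ (EuclideanSpace ℝ (Fin 4)) :=
    b.reindex σ.symm with hb'
  have hb'coe : ⇑b' = e ∘ σ := by
    funext i; rw [hb', Basis.reindex_apply, Equiv.symm_symm, hbcoe]; rfl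
  rw [← hb'coe, SmoothOrientation.isPosFrame_iff_orientation_eq, hox]
  -- the standard basis, reindexed: its orientation is `euclideanOrientation 4`
  set std := (EuclideanSpace.basisFun (Fin 4) ℝ).toBasis with hstd
  have heucl : euclideanOrientation 4 = (std.reindex σ.symm).orientation := rfl
  have hdet : (std.reindex σ.symm).det b' = std.det e := by
    rw [hb'coe, Basis.det_reindex_symm]
  have hkey := det_mul_pfaffian_eq_one hM
  unfold signOrientationIn
  by_cases hpf : 0 < pfaffian α
  · rw [if_pos hpf, heucl, eq_comm, Basis.orientation_eq_iff_det_pos, hdet]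
    by_contra hle
    have : std.det e * pfaffian α ≤ 0 := mul_nonpos_of_nonpos_of_nonneg (not_lt.1 hle) hpf.le
    linarith
  · rw [if_neg hpf, heucl]
    refine ((std.reindex σ.symm).orientation_ne_iff_eq_neg _).1 fun heq ↦ ?_
    rw [eq_comm, Basis.orientation_eq_iff_det_pos, hdet] at heq
    have : std.det e * pfaffian α ≤ 0 := mul_nonpos_of_nonneg_of_nonpos heq.le (not_lt.1 hpf)
    linarith

end Model

/-! ### On the manifold -/

namespace AlmostComplexStructure.IsCompatibleWith

variable {N : Type*} [TopologicalSpace N] [ChartedSpace (EuclideanSpace ℝ (Fin 4)) N]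
  [IsManifold (𝓡 4) ∞ N] {J : AlmostComplexStructure (𝓡 4) ∞ N} {s : MForm (𝓡 4) N ℝ 2}
  (h : J.IsCompatibleWith s) (hs : IsSmoothForm s)
  (hnd : ∀ x (v : TangentSpace (𝓡 4) x), v ≠ 0 → ∃ w : TangentSpace (𝓡 4) x, s x ![v, w] ≠ 0)

/-- **Unitary frames are positive orthonormal frames for the symplectic orientation**
(McDuff–Salamon 2017, §4.1: a compatible `J` induces the symplectic orientation `ω ∧ ω > 0`;
Taubes 1995, §5 Step 1): a `g_J`-orthonormal frame with `e₁ = Je₀`, `e₃ = Je₂` is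
`IsPosOrthonormalFrame g_J (symplecticSmoothOrientation s)`. [cite: McDuffSalamon2017, §4.1 (4.1.2)] -/
theorem isPosOrthonormalFrame_of_unitary (x : N) {e : Fin 4 → TangentSpace (𝓡 4) x}
    (he : (h.metric hs).IsOrthonormalFrame x e) (h1 : e 1 = J x (e 0)) (h3 : e 3 = J x (e 2)) :
    IsPosOrthonormalFrame (h.metric hs) (symplecticSmoothOrientation s hs hnd) x e :=
  ⟨he, isPosFrame_of_twoForm_eq (symplecticSmoothOrientation s hs hnd) x
    (symplecticSmoothOrientation_apply s hs hnd x) (linearIndependent_of_isOrthonormalFrame _ he)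
    (h.twoForm_unitaryFrame_eq hs x he h1 h3)⟩

end AlmostComplexStructure.IsCompatibleWith

end Literature.Geometry.Symplectic

end
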